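import Mathlib
import HarnessLib

/-!
# Catalan box family — Genocchi numbers and their recurrence (kernel K5b, step 1 of 3)

HONEST FRAMING: systematic search; no irrationality claim unless certified.

Cell `pub-zeta5`, family-designer seat `fam-catalan` (generation 4), successor project "kernel K5b" of
`families/denom/K5B.md` §7 / `families/catalan/FAMILY.md` §11: upgrade the first link of the paper's (C6),
`8·ξ = −Θ₂(½) = Σ_{k≥1} G_k (−2)^{k+1}` in `ℚ₂`, from paper-proved to kernel-checked.  This file is the purely
combinatorial input: the Genocchi numbers `G_n := 2(1 − 2^n)·B_n` (Mathlib's `bernoulli`, `B₁ = −½`), their exponential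
generating function `𝒢(t) = Σ G_n t^n/n! = 2t/(e^t + 1)` obtained from Mathlib's `bernoulliPowerSeries_mul_exp_sub_one`,
and the recurrence `Σ_{k=0}^{n} binom(n,k) G_k + G_n = 2·[n = 1]` read off from `𝒢·(e^t + 1) = 2t`.
Nothing 2-adic and nothing about `ξ` happens here.  0 sorry.
-/

open Finset PowerSeries Nat

namespace Summit.KontsevichZagierPeriods.Zeta5Search.CatalanTwoAdicGenocchi

/-- Genocchi numbers `G_n := 2(1 − 2^n)·B_n = (2 − 2^{n+1})·B_n` (with `B₁ = −½`): `0, 1, −1, 0, 1, 0, −3, 0, 17, …`. -/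
def genocchi (n : ℕ) : ℚ := (2 - 2 ^ (n + 1)) * bernoulli n

/-- `G₀ = 0`. -/
theorem genocchi_zero : genocchi 0 = 0 := by norm_num [genocchi]

/-- `G₁ = 1`. -/
theorem genocchi_one : genocchi 1 = 1 := by rw [genocchi, bernoulli_one]; norm_num

/-- `G₂ = −1`. -/
theorem genocchi_two : genocchi 2 = -1 := by
  rw [genocchi, bernoulli_eq_bernoulli'_of_ne_one (by decide), bernoulli'_two]; norm_num

/-- `G₄ = 1`. -/
theorem genocchi_four : genocchi 4 = 1 := by
  rw [genocchi, bernoulli_eq_bernoulli'_of_ne_one (by decide), bernoulli'_four]; norm_num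

/-- The exponential generating function `𝒢 := Σ_n G_n X^n / n!` of the Genocchi numbers. -/
def genocchiPowerSeries : ℚ⟦X⟧ := mk fun n => genocchi n / n !

/-- `𝒢 = 2·B(X) − 2·B(2X)` where `B = bernoulliPowerSeries ℚ` (coefficientwise: `G_n/n! = 2B_n/n! − 2·2^n B_n/n!`). -/
theorem genocchiPowerSeries_eq :
    genocchiPowerSeries = C (2 : ℚ) * bernoulliPowerSeries ℚ - C (2 : ℚ) * rescale 2 (bernoulliPowerSeries ℚ) := by
  ext n
  simp only [genocchiPowerSeries, bernoulliPowerSeries, coeff_mk, map_sub, coeff_C_mul, coeff_rescale,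
    Algebra.algebraMap_self, RingHom.id_apply, genocchi]
  ring

/-- `exp − 1 ≠ 0` in `ℚ⟦X⟧` (its `X¹`-coefficient is `1`). -/
theorem exp_sub_one_ne_zero : (exp ℚ - 1 : ℚ⟦X⟧) ≠ 0 := by
  intro h
  have h1 := congrArg (coeff 1) h
  simp [coeff_exp, coeff_one] at h1

/-- **Genocchi generating function:** `𝒢 · (e^X + 1) = 2X`, i.e. `Σ G_n X^n/n! = 2X/(e^X + 1)`. -/
theorem genocchiPowerSeries_mul_exp_add_one : genocchiPowerSeries * (exp ℚ + 1) = 2 * X := by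
  have hB : bernoulliPowerSeries ℚ * (exp ℚ - 1) = X := bernoulliPowerSeries_mul_exp_sub_one ℚ
  -- rescale by 2:  B(2X)·(e^{2X} − 1) = 2X
  have hB2 : rescale 2 (bernoulliPowerSeries ℚ) * (exp ℚ ^ 2 - 1) = 2 * X := by
    have h := congrArg (rescale (2 : ℚ)) hB
    rw [map_mul, map_sub, map_one, rescale_X, map_ofNat] at h
    have he : rescale (2 : ℚ) (exp ℚ) = exp ℚ ^ 2 := by
      rw [exp_pow_eq_rescale_exp]; norm_num
    rw [he] at h
    exact h
  apply mul_left_cancel₀ exp_sub_one_ne_zero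
  rw [genocchiPowerSeries_eq, map_ofNat]
  linear_combination (2 * (exp ℚ + 1)) * hB - 2 * hB2

/-- **Genocchi recurrence:** `Σ_{k=0}^{n} binom(n,k)·G_k + G_n = 2·[n = 1]` (coefficient of `X^n` in `𝒢·(e^X+1) = 2X`, times `n!`). -/
theorem genocchi_recurrence (n : ℕ) :
    ∑ k ∈ range (n + 1), (n.choose k : ℚ) * genocchi k + genocchi n = if n = 1 then 2 else 0 := by
  have h := congrArg (coeff n) genocchiPowerSeries_mul_exp_add_one
  have hfact : ∀ m : ℕ, (m ! : ℚ) ≠ 0 := fun m => by exact_mod_cast factorial_ne_zero m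
  -- left-hand side: Σ_{k ≤ n} G_k/k! · 1/(n-k)!  +  G_n/n!
  have hL : coeff n (genocchiPowerSeries * (exp ℚ + 1)) =
      ∑ k ∈ range (n + 1), genocchi k / k ! * (1 / (n - k)!) + genocchi n / n ! := by
    rw [mul_add, mul_one, map_add, coeff_mul, Nat.sum_antidiagonal_eq_sum_range_succ_mk]
    simp [genocchiPowerSeries, coeff_mk, coeff_exp]
  -- right-hand side
  have hR : coeff n (2 * X : ℚ⟦X⟧) = if n = 1 then 2 else 0 := by
    rw [two_mul, map_add, coeff_X]; split_ifs <;> norm_num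
  rw [hL, hR] at h
  -- multiply by n!
  have h' := congrArg (fun x : ℚ => x * n !) h
  simp only [add_mul, sum_mul] at h'
  have hterm : ∀ k ∈ range (n + 1), genocchi k / k ! * (1 / (n - k)!) * (n ! : ℚ) = (n.choose k : ℚ) * genocchi k := by
    intro k hk
    have hkn : k ≤ n := Nat.lt_succ_iff.mp (mem_range.mp hk)
    rw [Nat.cast_choose ℚ hkn]
    field_simp
  rw [sum_congr rfl hterm, div_mul_cancel₀ _ (hfact n)] at h'
  rw [h']
  split_ifs with hn
  · subst hn; simp
  · simp

/-- Sanity (kernel arithmetic on the closed forms): `G₀, G₁, G₂, G₄ = 0, 1, −1, 1`. -/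
example : genocchi 0 = 0 ∧ genocchi 1 = 1 ∧ genocchi 2 = -1 ∧ genocchi 4 = 1 :=
  ⟨genocchi_zero, genocchi_one, genocchi_two, genocchi_four⟩

end Summit.KontsevichZagierPeriods.Zeta5Search.CatalanTwoAdicGenocchi
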